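import Mathlib
import Summits.Ventures.PercRepro2.PendantRoot
import Summits.Ventures.PercRepro2.PMK5PendantRoot
import Summits.Ventures.PercRepro2.PMK5PendantBMasses
import Summits.Ventures.PercRepro2.PMK5LocusZeroSS

/-!
# THEOREM 22 — THE EQUALITY LOCUS OF (HCOV) ON THE SIX-VERTEX FAMILY `K₅ + a₃ PENDANT AT A ROOT`
(blind cell PercRepro2, mine-2 g24; the lens «equality locus first» on the fourth six-vertex pendant family
(`K5.PendR.ends6r`: `K₅` on `o = 0, a₁ = 1, a₂ = 2, u = 3, b = 4` plus the pendant edge `{2, 5}` to the leaf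
`a₃ = 5` at the root `a₂`), every weight vector; on mine-a / typer-1's pendant-at-root identity
`PendantRoot.Gc_pendant_root`, the masses and cross slacks of `PMK5PendantBMasses.lean` and the same-side slack
`SS` of `PMK5LocusSS*` (its locus `RuleSS`))

Write `q = p 10` for the pendant weight and `s = p ∘ castSucc` for the `K₅` weights.  The identity
`Gc = (1 − q) P [2q · covC(oL, bL) − 2(1 − q) · covC(oH, bL) − 2 · covC(oL, bH)]` reads, in the slacks (**`gc6r_eq`**),
  `Gc(p) = 2 (1 − q) P · [q · SS + (1 − q) · Z_H + Z_L]`,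
`SS = P·A − oL·bL ≥ 0` the same-side Harris slack, `Z_L, Z_H ≥ 0` the two cross slacks of the `a₃`-inactive value.
The locus of `SS` is `RuleSS` (the root pair separates `o` from `b`, or `a₁` cannot reach `o` avoiding `a₂` —
480 / 1,024) and **`RuleSS ⊆ RuleA`** (`ruleA_of_ruleSS`, one `decide +kernel`; `RuleA` = the locus of `Z_L + Z_H`).
Hence, on the pendant face (`0 < q < 1`) the locus of (HCOV) on `K₅ + a₃ pendant at a₂` is EXACTLY `RuleSS`
(**`gc6r_pos_iff`** / **`gc6r_zero_iff`**; the zero side for every `q`): the `a₂`-clause of the `a₃`-isolated locus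
`RuleA` disappears when `a₃` hangs at `a₂` — the one asymmetric locus of the four pendant families; at `q = 0` the
locus is `RuleA` (Theorem 19 (b)), at `q = 1` (`a₃ = a₂`) the crux functional vanishes identically
(**`gc6r_glued_zero`**).  Census (second code, the exact centre values of `Gc` on `ends6r` at `q = 0, ½`): zero
faces 560 / 480 = `RuleA` / `RuleSS` on 1,024 / 1,024.  Standard axioms.
-/

namespace Summit.Ventures.PercRepro2

open Hub CovForm

namespace K5

namespace PM

set_option maxRecDepth 100000 in
/-- **Every `SS`-degenerate edge set is `A`-degenerate** (480 ⊆ 560). -/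
theorem ruleA_of_ruleSS : ∀ m : Fin 1024, RuleSS m = true → RuleA m = true := by
  decide +kernel

section Masses

variable {R : Type*} [Field R] [LinearOrder R] [IsStrictOrderedRing R]

/-- The same-side slack `SS = P·A − oL·bL`. -/
noncomputable def SSm (s : Fin 10 → R) : R := Pm s * Am s - oLm s * bLm s

/-- `SS ≥ 0` (Harris on `C₁`, `PendantRoot.covC_same_nonneg`). -/
lemma SSm_nonneg (s : Fin 10 → R) (hs : IsProbVec s) : 0 ≤ SSm s := by
  have := PendantRoot.covC_same_nonneg s ends5 hs 0 1 2 4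
  unfold PendantRoot.covC at this
  unfold SSm Pm Am oLm bLm Qev; linarith

omit [LinearOrder R] [IsStrictOrderedRing R] in
/-- **`SS` is the `SS` Bernstein form** `Σ bern s k · (cntPosSS k − cntNegSS k)`. -/
theorem SS_eq_bern (s : Fin 10 → R) :
    SSm s = ∑ k, bern s k * ((cntPosSS k : ℕ) - (cntNegSS k : ℕ) : R) := by
  rw [← ss_eq_bern]; rfl

end Masses

section Family

variable {R : Type*} [Field R] [LinearOrder R] [IsStrictOrderedRing R]

omit [LinearOrder R] [IsStrictOrderedRing R] in
/-- The connection events among the marks transfer (numeral forms). -/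
lemma c12r : connEvent PendR.ends6r 1 2 = PendR.resr ⁻¹' connEvent ends5 1 2 := by
  have h := PendR.connEvent6r_eq 1 2; rwa [Pendant.cs1, Pendant.cs2] at h
omit [LinearOrder R] [IsStrictOrderedRing R] in
/-- The connection events among the marks transfer (numeral forms). -/
lemma c14r : connEvent PendR.ends6r 1 4 = PendR.resr ⁻¹' connEvent ends5 1 4 := by
  have h := PendR.connEvent6r_eq 1 4; rwa [Pendant.cs1, Pendant.cs4] at h
omit [LinearOrder R] [IsStrictOrderedRing R] in
/-- The connection events among the marks transfer (numeral forms). -/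
lemma c24r : connEvent PendR.ends6r 2 4 = PendR.resr ⁻¹' connEvent ends5 2 4 := by
  have h := PendR.connEvent6r_eq 2 4; rwa [Pendant.cs2, Pendant.cs4] at h
omit [LinearOrder R] [IsStrictOrderedRing R] in
/-- The connection events among the marks transfer (numeral forms). -/
lemma c10r : connEvent PendR.ends6r 1 0 = PendR.resr ⁻¹' connEvent ends5 1 0 := by
  have h := PendR.connEvent6r_eq 1 0; rwa [Pendant.cs1, Pendant.cs0] at h
omit [LinearOrder R] [IsStrictOrderedRing R] in
/-- The connection events among the marks transfer (numeral forms). -/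
lemma c20r : connEvent PendR.ends6r 2 0 = PendR.resr ⁻¹' connEvent ends5 2 0 := by
  have h := PendR.connEvent6r_eq 2 0; rwa [Pendant.cs2, Pendant.cs0] at h
omit [LinearOrder R] [IsStrictOrderedRing R] in
/-- `Q` transfers. -/
lemma avoidAll6r : avoidAll PendR.ends6r 2 {1} = PendR.resr ⁻¹' avoidAll ends5 2 {1} := by
  rw [PMPendant.avoidAll_eq_compl, PMPendant.avoidAll_eq_compl, c12r, Set.preimage_compl]

omit [LinearOrder R] [IsStrictOrderedRing R] in
/-- The pendant edge of `ends6r` joins `a₃ = 5` to `a₂ = 2`. -/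
lemma ends6r_last' : PendR.ends6r (Fin.last 10) = s(5, 2) := by
  rw [PendR.ends6r_last, Sym2.eq_swap]

/-- **The crux functional on `K₅ + a₃ pendant at a₂`**: `2 (1 − q) P [q · SS + (1 − q) · Z_H + Z_L]`. -/
theorem gc6r_eq (p : Fin 11 → R) :
    Gc p PendR.ends6r 0 1 2 5 4 =
      2 * (1 - p (Fin.last 10)) * Pm (p ∘ Fin.castSucc) *
        (p (Fin.last 10) * SSm (p ∘ Fin.castSucc) + (1 - p (Fin.last 10)) * ZH (p ∘ Fin.castSucc) +
          ZL (p ∘ Fin.castSucc)) := by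
  rw [PendantRoot.Gc_pendant_root p PendR.ends6r ends6r_last' PendR.leaf_five_r (by decide) (by decide)
    (by decide) (by decide)]
  unfold PendantRoot.covC
  simp only [avoidAll6r, c14r, c24r, c10r, c20r, ← Set.preimage_inter, PendR.prob_resr]
  unfold SSm ZL ZH Pm Am oLm bLm bHm Ddm oHm Cm Qev
  ring

end Family

section Locus

variable {R : Type*} [Field R] [LinearOrder R] [IsStrictOrderedRing R]

/-- **THEOREM 22 — THE ZERO SIDE**: on every `SS`-degenerate base edge set `m`, `Gc p ends6r 0 1 2 5 4 = 0` for every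
admissible `p` whose `K₅` weights are supported on `m` — for every pendant weight. -/
theorem gc6r_zero_of_face (m : ℕ) (hm : m < 1024) (hr : RuleSS m = true) (p : Fin 11 → R)
    (hp : ∀ e : Fin 11, 0 ≤ p e ∧ p e ≤ 1)
    (hp₀ : ∀ e : Fin 10, m.testBit e = false → p (Fin.castSucc e) = 0) :
    Gc p PendR.ends6r 0 1 2 5 4 = 0 := by
  rw [gc6r_eq]
  set s := p ∘ Fin.castSucc with hs_def
  have hs : IsProbVec s := ⟨fun _ => (hp _).1, fun _ => (hp _).2⟩
  have hs₀ : ∀ e : Fin 10, m.testBit e = false → s e = 0 := fun e he => hp₀ e he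
  have hSS : SSm s = 0 := by rw [SS_eq_bern]; exact ss_K5_zero_of_face m hm hr s hs₀
  have hI : 2 * Pm s * (ZL s + ZH s) = 0 := by
    rw [twoPZ_eq_bern]; exact i_K5_zero_of_face m hm (ruleA_of_ruleSS ⟨m, hm⟩ hr) s hs₀
  rcases (Pm_nonneg s hs).lt_or_eq with hP | hP
  · have hZ : ZL s + ZH s = 0 := by
      rcases mul_eq_zero.1 hI with h | h
      · exfalso; linarith
      · exact h
    have hZL : ZL s = 0 := by linarith [ZL_nonneg' s hs, ZH_nonneg' s hs]
    have hZH : ZH s = 0 := by linarith [ZL_nonneg' s hs, ZH_nonneg' s hs]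
    rw [hSS, hZL, hZH]; ring
  · rw [← hP]; ring

/-- **THEOREM 22 — THE POSITIVE SIDE**: on every base edge set `m` that is not `SS`-degenerate,
`0 < Gc p ends6r 0 1 2 5 4` at every weight vector interior on the base with pendant weight `0 < q < 1`. -/
theorem gc6r_pos_of_face (m : ℕ) (hm : m < 1024) (hr : RuleSS m = false) (p : Fin 11 → R)
    (hp₁ : ∀ e : Fin 10, m.testBit e = true → 0 < p (Fin.castSucc e) ∧ p (Fin.castSucc e) < 1)
    (hp₀ : ∀ e : Fin 10, m.testBit e = false → p (Fin.castSucc e) = 0)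
    (hq : 0 < p (Fin.last 10) ∧ p (Fin.last 10) < 1) :
    0 < Gc p PendR.ends6r 0 1 2 5 4 := by
  rw [gc6r_eq]
  set s := p ∘ Fin.castSucc with hs_def
  have h01 : ∀ e : Fin 10, 0 ≤ s e ∧ s e ≤ 1 := fun e => by
    by_cases he : m.testBit e = true
    · exact ⟨(hp₁ e he).1.le, (hp₁ e he).2.le⟩
    · show 0 ≤ p (Fin.castSucc e) ∧ p (Fin.castSucc e) ≤ 1
      rw [hp₀ e (by simpa using he)]
      exact ⟨le_rfl, zero_le_one⟩
  have hs : IsProbVec s := ⟨fun e => (h01 e).1, fun e => (h01 e).2⟩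
  have hlt : ∀ e, s e < 1 := fun e => by
    by_cases he : m.testBit e = true
    · exact (hp₁ e he).2
    · show p (Fin.castSucc e) < 1
      rw [hp₀ e (by simpa using he)]; exact zero_lt_one
  have hs₁ : ∀ e : Fin 10, m.testBit e = true → 0 < s e ∧ s e < 1 := fun e he => hp₁ e he
  have hs₀ : ∀ e : Fin 10, m.testBit e = false → s e = 0 := fun e he => hp₀ e he
  have hP := Pm_pos s hs hlt
  have hq1 : 0 < 1 - p (Fin.last 10) := sub_pos.2 hq.2
  have hSS := SSm_nonneg s hs
  have hZL := ZL_nonneg' s hs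
  have hZH := ZH_nonneg' s hs
  have hbr : 0 < p (Fin.last 10) * SSm s + (1 - p (Fin.last 10)) * ZH s + ZL s := by
    rcases Bool.eq_false_or_eq_true (RuleA m) with hA | hA
    · -- `RuleA` holds, `RuleSS` fails: `SS > 0`
      have hS : 0 < SSm s := by rw [SS_eq_bern]; exact ss_K5_pos_of_face m hm hr s hs₁ hs₀
      have := mul_pos hq.1 hS
      have := mul_nonneg hq1.le hZH
      linarith
    · -- `RuleA` fails: `Z_L + Z_H > 0`
      have hI : 0 < 2 * Pm s * (ZL s + ZH s) := by
        rw [twoPZ_eq_bern]; exact i_K5_pos_of_face m hm hA s hs₁ hs₀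
      have hZ : 0 < ZL s + ZH s := by
        rcases (add_nonneg hZL hZH).lt_or_eq with h | h
        · exact h
        · exfalso; rw [← h, mul_zero] at hI; exact lt_irrefl _ hI
      have h3 : (1 - p (Fin.last 10)) * (ZL s + ZH s) ≤ (1 - p (Fin.last 10)) * ZH s + ZL s := by
        have : (1 - p (Fin.last 10)) * ZL s ≤ ZL s := by
          have := mul_le_of_le_one_left hZL (by linarith : 1 - p (Fin.last 10) ≤ 1)
          linarith
        linarith
      have := mul_pos hq1 hZ
      have := mul_nonneg hq.1.le hSS
      linarith
  have h2 : 0 < 2 * (1 - p (Fin.last 10)) * Pm s := by positivity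
  exact mul_pos h2 hbr

/-- The centre of the base face with pendant weight `½`. -/
noncomputable def centreR (m : ℕ) : Fin 11 → R := Fin.snoc (α := fun _ => R) (centre m) (1 / 2)

omit [LinearOrder R] [IsStrictOrderedRing R] in
/-- `centreR` on the `K₅` edges is the centre of `m`. -/
lemma centreR_castSucc (m : ℕ) (e : Fin 10) : centreR (R := R) m (Fin.castSucc e) = centre m e := by
  unfold centreR; simp [Fin.snoc_castSucc]

omit [LinearOrder R] [IsStrictOrderedRing R] in
/-- The pendant weight of `centreR` is `½`. -/
lemma centreR_last (m : ℕ) : centreR (R := R) m (Fin.last 10) = 1 / 2 :=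
  Fin.snoc_last _ _

/-- `centreR` is admissible. -/
lemma centreR_01 (m : ℕ) : ∀ e : Fin 11, 0 ≤ centreR (R := R) m e ∧ centreR (R := R) m e ≤ 1 := by
  intro e
  induction e using Fin.lastCases with
  | last => rw [centreR_last]; exact ⟨by norm_num, by norm_num⟩
  | cast e => rw [centreR_castSucc]; exact centre_01 m e

/-- **THEOREM 22, FIRST «IFF»**: on `K₅ + a₃ pendant at a₂`, `Gc > 0` at every weight vector interior on the pendant
face of `m` (`0 < q < 1`) ⟺ `m` is not `SS`-degenerate. -/
theorem gc6r_pos_iff (m : ℕ) (hm : m < 1024) :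
    (∀ p : Fin 11 → R, (∀ e : Fin 10, m.testBit e = true → 0 < p (Fin.castSucc e) ∧ p (Fin.castSucc e) < 1) →
      (∀ e : Fin 10, m.testBit e = false → p (Fin.castSucc e) = 0) →
      (0 < p (Fin.last 10) ∧ p (Fin.last 10) < 1) → 0 < Gc p PendR.ends6r 0 1 2 5 4) ↔ RuleSS m = false := by
  constructor
  · intro h
    rcases Bool.eq_false_or_eq_true (RuleSS m) with hr | hr
    · exfalso
      have hpos := h (centreR (R := R) m) (fun e he => by rw [centreR_castSucc]; exact centre_on_pos he)
        (fun e he => by rw [centreR_castSucc]; exact centre_off he)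
        (by rw [centreR_last]; exact ⟨by norm_num, by norm_num⟩)
      have hzero := gc6r_zero_of_face m hm hr (centreR (R := R) m) (centreR_01 m)
        (fun e he => by rw [centreR_castSucc]; exact centre_off he)
      rw [hzero] at hpos
      exact lt_irrefl _ hpos
    · exact hr
  · intro hr p hp₁ hp₀ hq
    exact gc6r_pos_of_face m hm hr p hp₁ hp₀ hq

/-- **THEOREM 22, SECOND «IFF»**: on `K₅ + a₃ pendant at a₂`, `Gc = 0` at every admissible weight vector whose `K₅`
weights are supported on `m` (the pendant weight free) ⟺ `m` is `SS`-degenerate. -/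
theorem gc6r_zero_iff (m : ℕ) (hm : m < 1024) :
    (∀ p : Fin 11 → R, (∀ e : Fin 11, 0 ≤ p e ∧ p e ≤ 1) →
      (∀ e : Fin 10, m.testBit e = false → p (Fin.castSucc e) = 0) →
      Gc p PendR.ends6r 0 1 2 5 4 = 0) ↔ RuleSS m = true := by
  constructor
  · intro h
    rcases Bool.eq_false_or_eq_true (RuleSS m) with hr | hr
    · exact hr
    · exfalso
      have hpos := gc6r_pos_of_face m hm hr (centreR (R := R) m)
        (fun e he => by rw [centreR_castSucc]; exact centre_on_pos he)
        (fun e he => by rw [centreR_castSucc]; exact centre_off he)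
        (by rw [centreR_last]; exact ⟨by norm_num, by norm_num⟩)
      have hzero := h (centreR (R := R) m) (centreR_01 m)
        (fun e he => by rw [centreR_castSucc]; exact centre_off he)
      rw [hzero] at hpos
      exact lt_irrefl _ hpos
  · intro hr p hp hp₀
    exact gc6r_zero_of_face m hm hr p hp hp₀

/-- **The glued face `q = 1` (`a₃ = a₂`)**: the crux functional vanishes identically. -/
theorem gc6r_glued_zero (p : Fin 11 → R) :
    Gc (Function.update p (Fin.last 10) 1) PendR.ends6r 0 1 2 5 4 = 0 := by
  rw [gc6r_eq, Function.update_self]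
  ring

end Locus

end PM

end K5

end Summit.Ventures.PercRepro2
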